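import Mathlib
import HarnessLib

/-!
# Very general points: non-countable sets in a domain avoid countably many hypersurfaces
# (helper for `AnchorsAtGenericHodgeLocusPoints`, stmt-HodgeConjecture-13944)

Route `PadicSemiregularLift` of `HodgeConjecture`, informal support item P2b
`AnchorsAtGenericHodgeLocusPoints`, abelian half (B1), step "a `W(𝔽̄_p)`-point of the residue
polydisc of a basic `𝔽̄_p`-point avoiding the countably many proper `ℚ̄`-closed subvarieties exists
(Baire; Strassmann) and is `ℚ̄`-generic". This file proves the algebraic core of that step over real
carriers, in the generality in which every "very general point" argument reuses it:

* `exists_mem_forall_eval_ne_zero` — one variable: in a domain `R`, a set `S ⊆ R` that is NOT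
  countable contains a point at which countably many nonzero polynomials are all nonzero (each has
  finitely many roots, `Polynomial.finite_setOf_isRoot`);
* `exists_forall_mvPolynomial_eval_ne_zero` — `d` variables, coordinatewise constraints: given sets
  `S₀, …, S_{d-1} ⊆ R`, none countable, and countably many NONZERO `fᵢ ∈ R[x₀, …, x_{d-1}]`, there is
  `x` with `xⱼ ∈ Sⱼ` for all `j` and `fᵢ(x) ≠ 0` for all `i` (induction on `d` through
  `MvPolynomial.finSuccEquiv`: first make all leading coefficients nonzero, then choose the last
  coordinate off the countably many roots; `MvPolynomial.eval_eq_eval_mv_eval'`);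
* `not_countable_univ_wittVector`, `injective_residueDisc_param`, `not_countable_residueDisc` — the
  Witt ring `W(k)` of a nontrivial ring is not countable (`#W(k) = #k^ℵ₀ ≥ 2^ℵ₀`), hence neither is
  any residue disc `a + p W(k)` when `k` is a domain of characteristic `p` (`w ↦ a + p w` is
  injective);
* `exists_forall_mvPolynomial_eval_ne_zero_residueDisc` — **very general `W(k)`-points of a residue
  polydisc**: for `k` a domain of characteristic `p`, every centre `a ∈ W(k)^d` and countably many
  nonzero `fᵢ`, some `x ∈ a + p W(k)^d` has `fᵢ(x) ≠ 0` for all `i`.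

References: folklore ("very general = off a countable union of proper closed subsets");
A. Ogus, *Hodge cycles and crystalline cohomology*, LNM 900 (1982), proof of (4.12) (the
`W`-valued points of a residue disc are Zariski dense) [Ogus1982].
-/

-- the summit-side namespace `Summit.HodgeConjecture.HodgeConjecture.…` (summit = sub-problem, D-0017)
-- repeats a component by design; the linter would flag every declaration.
set_option linter.dupNamespace false

namespace Summit.HodgeConjecture.HodgeConjecture.Theorems.AnchorsAtGenericHodgeLocusPoints

open MvPolynomial

/-- **One variable.** In a domain `R`, if `S ⊆ R` is not countable and `(Qᵢ)` is a countable family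
of nonzero polynomials, some `t ∈ S` is a root of no `Qᵢ` (the roots of all the `Qᵢ` form a
countable set). [folklore] -/
theorem exists_mem_forall_eval_ne_zero {R : Type*} [CommRing R] [IsDomain R] {S : Set R}
    (hS : ¬ S.Countable) {ι : Type*} [Countable ι] (Q : ι → Polynomial R) (hQ : ∀ i, Q i ≠ 0) :
    ∃ t ∈ S, ∀ i, (Q i).eval t ≠ 0 := by
  by_contra h
  push Not at h
  apply hS
  have hc : ({t | ∃ i, (Q i).IsRoot t} : Set R).Countable := by
    have : ({t | ∃ i, (Q i).IsRoot t} : Set R) = ⋃ i, {t | (Q i).IsRoot t} := by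
      ext t
      simp
    rw [this]
    exact Set.countable_iUnion fun i => (Polynomial.finite_setOf_isRoot (hQ i)).countable
  exact hc.mono fun t ht => h t ht

/-- **Very general points with coordinatewise constraints.** In a domain `R`, let
`S₀, …, S_{d-1} ⊆ R` be sets none of which is countable. For every countable family of NONZERO
polynomials `fᵢ ∈ R[x₀, …, x_{d-1}]` there is a point `x` with `xⱼ ∈ Sⱼ` for all `j` and `fᵢ(x) ≠ 0`
for all `i`: `∏ Sⱼ` is not covered by countably many hypersurfaces. [folklore] -/
theorem exists_forall_mvPolynomial_eval_ne_zero {R : Type*} [CommRing R] [IsDomain R]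
    {ι : Type*} [Countable ι] :
    ∀ (d : ℕ) (S : Fin d → Set R), (∀ j, ¬ (S j).Countable) →
      ∀ f : ι → MvPolynomial (Fin d) R, (∀ i, f i ≠ 0) →
        ∃ x : Fin d → R, (∀ j, x j ∈ S j) ∧ ∀ i, MvPolynomial.eval x (f i) ≠ 0 := by
  intro d
  induction d with
  | zero =>
    intro S _ f hf
    refine ⟨Fin.elim0, fun j => j.elim0, fun i h => hf i ?_⟩
    rw [eq_C_of_isEmpty (f i)] at h ⊢
    rw [eval_C] at h
    rw [h, C_0]
  | succ d ih =>
    intro S hS f hf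
    have hP0 : ∀ i, finSuccEquiv R d (f i) ≠ 0 := fun i h =>
      hf i ((EmbeddingLike.map_eq_zero_iff (f := finSuccEquiv R d)).1 h)
    obtain ⟨y, hyS, hy⟩ := ih (Fin.tail S) (fun j => hS j.succ)
      (fun i => (finSuccEquiv R d (f i)).leadingCoeff)
      (fun i => Polynomial.leadingCoeff_ne_zero.2 (hP0 i))
    have hQ : ∀ i, (finSuccEquiv R d (f i)).map (eval y) ≠ 0 := fun i => by
      rw [← Polynomial.leadingCoeff_ne_zero,
        Polynomial.leadingCoeff_map_of_leadingCoeff_ne_zero _ (hy i)]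
      exact hy i
    obtain ⟨t, htS, ht⟩ := exists_mem_forall_eval_ne_zero (hS 0) _ hQ
    refine ⟨Fin.cons t y, Fin.cases (by simpa using htS) (fun j => by
        rw [Fin.cons_succ]
        exact hyS j),
      fun i => ?_⟩
    rw [eval_eq_eval_mv_eval']
    exact ht i

/-! ### The residue-polydisc form over the Witt vectors -/

/-- The Witt ring `W(k)` of a nontrivial ring is NOT countable: `#W(k) = #(ℕ → k) = #k^ℵ₀ ≥ 2^ℵ₀ > ℵ₀`
(a Witt vector is its sequence of components). [folklore] -/
theorem not_countable_univ_wittVector (p : ℕ) (k : Type) [Nontrivial k] :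
    ¬ (Set.univ : Set (WittVector p k)).Countable := by
  rw [Set.countable_univ_iff, ← Cardinal.mk_le_aleph0_iff, not_le]
  have h : Cardinal.mk (WittVector p k) = Cardinal.mk (ℕ → k) :=
    Cardinal.mk_congr
      { toFun := fun x => x.coeff
        invFun := fun f => WittVector.mk p f
        left_inv := fun x => by cases x; rfl
        right_inv := fun f => rfl }
  rw [h, ← Cardinal.power_def, Cardinal.mk_nat]
  calc Cardinal.aleph0 < Cardinal.continuum := Cardinal.aleph0_lt_continuum
    _ = 2 ^ Cardinal.aleph0 := Cardinal.two_power_aleph0.symm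
    _ ≤ Cardinal.mk k ^ Cardinal.aleph0 :=
      Cardinal.power_le_power_right (Cardinal.two_le_iff.2 (exists_pair_ne k))

section Witt

variable (p : ℕ) [Fact p.Prime] (k : Type) [CommRing k] [IsDomain k] [CharP k p]

/-- The parametrisation `w ↦ a + p w` of the residue disc around `a` is injective on the Witt ring of a
domain of characteristic `p` (`p ≠ 0` in the domain `W(k)`, `WittVector.p_nonzero`). [folklore] -/
theorem injective_residueDisc_param (a : WittVector p k) :
    Function.Injective fun w : WittVector p k => a + (p : WittVector p k) * w := by
  intro w w' hw
  have h1 : (p : WittVector p k) * w = (p : WittVector p k) * w' := add_left_cancel hw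
  exact mul_left_cancel₀ (WittVector.p_nonzero p k) h1

/-- A residue disc `a + p W(k)` (`k` a domain of characteristic `p`) is not countable. [folklore] -/
theorem not_countable_residueDisc (a : WittVector p k) :
    ¬ (Set.range fun w : WittVector p k => a + (p : WittVector p k) * w).Countable := fun h =>
  not_countable_univ_wittVector p k
    ((Set.mapsTo_range _ Set.univ).countable_of_injOn
      ((injective_residueDisc_param p k a).injOn) h)

/-- **Very general `W(k)`-points of a residue polydisc.** Let `k` be a domain of characteristic `p`
(e.g. `𝔽̄_p`), `a ∈ W(k)^d` a centre and `(fᵢ)` a countable family of nonzero polynomials in `d`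
variables over `W(k)`. Then some point `x` of the residue polydisc `a + p W(k)^d` — `xⱼ = aⱼ + p wⱼ`
for all `j`, i.e. a `W(k)`-valued point reducing to the reduction of `a` — has `fᵢ(x) ≠ 0` for every
`i`: the `W`-points of a residue polydisc do not lie on countably many hypersurfaces (the step
"(Baire; Strassmann)" of the `ℚ̄`-genericity argument, in polynomial form). [cite: Ogus1982, proof of (4.12)] -/
theorem exists_forall_mvPolynomial_eval_ne_zero_residueDisc {ι : Type*} [Countable ι] (d : ℕ)
    (a : Fin d → WittVector p k) (f : ι → MvPolynomial (Fin d) (WittVector p k))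
    (hf : ∀ i, f i ≠ 0) :
    ∃ x : Fin d → WittVector p k,
      (∀ j, x j ∈ Set.range fun w : WittVector p k => a j + (p : WittVector p k) * w) ∧
        ∀ i, MvPolynomial.eval x (f i) ≠ 0 :=
  exists_forall_mvPolynomial_eval_ne_zero d
    (fun j => Set.range fun w : WittVector p k => a j + (p : WittVector p k) * w)
    (fun j => not_countable_residueDisc p k (a j)) f hf

end Witt

end Summit.HodgeConjecture.HodgeConjecture.Theorems.AnchorsAtGenericHodgeLocusPoints
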